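import Summits.CriticalPhenomena.PercolationContinuityZ3.Theorems.PercNearOneGluingNoHeavyQuantFarGate3PinchRData87
import Summits.CriticalPhenomena.PercolationContinuityZ3.Theorems.PercNearOneGluingNoHeavyQuantFarGate3PinchRTables
import Summits.CriticalPhenomena.PercolationContinuityZ3.Theorems.PercNearOneGluingNoHeavyQuantFarGate3CertNParts
import HarnessLib

/-!
# QUANT lane R8, front "FAR beyond trees", layer one — THE DEGREE-THREE GATE AT THE OBSERVER: pinch chart R box-certificate DATA — pinchR_d93

builds on p205010 (kernel theorem, internal audit signed; external expert review pending)

Support file (`--supports stmt-CriticalPhenomena-4575`), seats `prim-quant-p1` gen 35 (engine, charts) and gen 36 (certificate data); memos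
`run/shared/lean/prim/quant/prim-quant-p1-g35/FOR-LEAD-GATE3-PINCH.md`, `…/prim-quant-p1-g36/`.  GENERATED by `mktreeN2.py --parts` from the
exact-verified LP output of the kit jobs listed in the g36 memo (each certificate re-checked by the Python mirror `boxcertn.verify_exact` before emission); standard
axioms; no sorries.  Per certificate: `def …_kN : CertN.Cert`, 36 monomial checks `…_kN_pMM` and `…_kN_e`, `…_kN_b` by `decide +kernel`, the
assembled check `…_kN_ok` (`CertN.check_of_parts`) and the leaf theorem `…_kN_thm` (`CertN.boxOKR_leaf`); then `pinchR_d93` dispatches along the k-d tree.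
[this work].
-/

namespace Summit.CriticalPhenomena.PercolationContinuityZ3.Theorems

namespace Quant

/-- Chart R has no bad point with `y ∈ [1/64, 9/512]`, `a ∈ [3/16, 1/4]`, `b ∈ [1/8, 1/4]`, `c ∈ [-1, -3/4]` — 1 kernel-checked certificate. [this work] -/
theorem pinchR_d93 : CertN.BoxOKR PinchR.spec ((1 : ℝ) / 64) ((9 : ℝ) / 512) ((3 : ℝ) / 16) ((1 : ℝ) / 4) ((1 : ℝ) / 8) ((1 : ℝ) / 4) (-1 : ℝ) ((-3 : ℝ) / 4) := by
  intro y a b c hylo hyhi halo hahi hblo hbhi hclo hchi v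
  exact pinchR_d87_k0_thm y a b c (by linarith) (by linarith) (by linarith) (by linarith) (by linarith) (by linarith) (by linarith) (by linarith) v

end Quant

end Summit.CriticalPhenomena.PercolationContinuityZ3.Theorems
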